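import Literature.Computability.Cryptography.CsidhTorsorFamily
import Literature.Computability.Cryptography.CsidhActionCompProofs
import HarnessLib

/-!
# The CSIDH torsor family satisfies the thirteen torsor axioms of the white-box interface

Topic `Computability/Cryptography`; proofs-only companion (theorems only, no definition, no named
fact) of `CsidhTorsorFamily.lean` (definition item `defn-csidhTorsorFamily`, route
QuantumAdvantage/PadKuperberg, item CsidhInstantiation). For the family
`csidhLab csidhElt csidhOne csidhMul csidhAct csidhGens` at a threshold `P₀` it proves, for
**every** parameter string (valid ones carry the CSIDH torsor of the prime they name, invalid
ones the trivial one-point torsor):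

* the group axioms (interface clauses 1, 3, 4, 5, 6: `csidhLab_csidhMul`,
  `csidhMul_csidhOne_left`, `csidhMul_assoc`, `csidhMul_comm`, `exists_csidhMul_eq_csidhOne`),
  unconditionally, from Cox Thm. 7.7 (the tree's theorem `cox_formClassGroup_holds`: labels of
  discriminant `-4p` ↔ `cl(ℤ[√-p])`);
* the action axioms (clauses 7, 8, 9: `csidhElt_csidhAct`, `csidhAct_csidhOne`,
  `csidhAct_csidhMul`), unconditionally, from clauses (1)–(2) of CSIDH Thm. 7 as proved in the
  tree (`isCoeff_act'`, `act_principalForm'`, `act_comp'` of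
  `CsidhActionExistenceEvenProofs.lean` / `CsidhActionCompProofs.lean`);
* regularity (clause 10: `existsUnique_csidhAct_eq`) from clause (3) of CSIDH Thm. 7 (free and
  transitive action) at the primes `p ≡ 3 (mod 8)`, `p ≥ max 5 P₀`, taken as a hypothesis;
* generation (clause 13: `exists_eq_foldr_of_closure_eq_top`) from
  `Subgroup.closure (classes of gens p) = ⊤`, taken as a hypothesis (under ERH it holds for
  `p ≥ P₀` by `exists_closure_toClass_gens_eq_top`), through the finite-abelian-group lemma
  `exists_eq_prod_zipWith_pow_of_mem_closure` (every element of the subgroup generated by a list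
  is an ordered product of natural powers of its members) and the transport lemmas
  `iterate_csidhMul_csidhOne`, `foldr_csidhMul_map`;
* clauses 2, 11, 12 are in `CsidhTorsorFamily.lean` (`csidhLab_csidhOne`, `length_le_of_csidhLab`,
  `csidhLab_of_mem_csidhGens`);
* the bundle `torsorAxioms P₀ hfree hgen` — the thirteen clauses in the order and shape of the
  route's `TorsorHard` with `lab := csidhLab P₀`, …, `gens := csidhGens P₀` — and
  `exists_torsorAxioms : csidh_classGroupAction → jmv_smallPrimesGenerate →
  ExtendedRiemannHypothesis → ∃ P₀, …` from the named facts as stated in the tree.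

No complexity statement is made (the six `PolyTimeComputable` clauses and the hardness conjunct of
`TorsorHard` are not touched here).

## References

* [CastryckEtAl2018] W. Castryck, T. Lange, C. Martindale, L. Panny, J. Renes, *CSIDH*,
  ASIACRYPT 2018, §3 Thm. 7, §5 Prop. 8.
* [Cox2013] D. A. Cox, *Primes of the form x² + ny²*, 2nd ed., Thm. 7.7.
* [JaoMillerVenkatesan2009] D. Jao, S. D. Miller, R. Venkatesan, J. Number Theory 129 (2009),
  Cor. 1.3 (generation under GRH, through `CsidhGenerators.lean`).
-/

noncomputable section

open scoped Classical

namespace Literature.Computability.Cryptography.Csidh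

open _root_.Computability
open Literature.Computability.Complexity
open Literature.NumberTheory.QuadraticFields.Quadratic
open Literature.NumberTheory.QuadraticFields.Quadratic.BinQF

attribute [local instance] isDomain_zsqrtd_neg

/-! ### Group axioms (clauses 1, 3, 4, 5, 6), unconditionally from Cox Thm. 7.7 -/

section Group

variable (P₀ : ℕ) (prm : List Bool)

/-- **Clause 1**: labels are closed under the law. [folklore] -/
theorem csidhLab_csidhMul {g h : List Bool} (hg : csidhLab P₀ prm g = true)
    (hh : csidhLab P₀ prm h = true) : csidhLab P₀ prm (csidhMul P₀ prm g h) = true := by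
  rcases isValidParam_cases P₀ prm with hn | ⟨p, _, h8, h5, hP, rfl⟩
  · rw [csidhMul_of_not hn, csidhLab_of_not hn]
    rfl
  · have hv := isValidParam_param h8 h5 hP
    obtain ⟨f, hf, rfl⟩ := (csidhLab_param_iff hv _).1 hg
    obtain ⟨f', hf', rfl⟩ := (csidhLab_param_iff hv _).1 hh
    rw [csidhMul_param hv hf hf', csidhLab_param_encForm hv, decide_eq_true_iff]
    exact isLabel_comp cox_formClassGroup_holds (by have := h5; omega) _ _

/-- **Clause 3**: the unit is a left identity on labels. [folklore] -/
theorem csidhMul_csidhOne_left {g : List Bool} (hg : csidhLab P₀ prm g = true) :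
    csidhMul P₀ prm (csidhOne P₀ prm) g = g := by
  rcases isValidParam_cases P₀ prm with hn | ⟨p, _, h8, h5, hP, rfl⟩
  · rw [csidhMul_of_not hn, eq_nil_of_csidhLab_of_not hn hg]
  · have hv := isValidParam_param h8 h5 hP
    have hd : (-(p : ℤ)) < 0 := by have := h5; omega
    obtain ⟨f, hf, rfl⟩ := (csidhLab_param_iff hv _).1 hg
    rw [csidhOne_param hv, csidhMul_param hv (isLabel_principalForm _ hd) hf,
      principalForm_comp cox_formClassGroup_holds hd hf]

/-- **Clause 4**: the law is associative on labels. [folklore] -/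
theorem csidhMul_assoc {g h k : List Bool} (hg : csidhLab P₀ prm g = true)
    (hh : csidhLab P₀ prm h = true) (hk : csidhLab P₀ prm k = true) :
    csidhMul P₀ prm (csidhMul P₀ prm g h) k = csidhMul P₀ prm g (csidhMul P₀ prm h k) := by
  rcases isValidParam_cases P₀ prm with hn | ⟨p, _, h8, h5, hP, rfl⟩
  · rw [csidhMul_of_not hn, csidhMul_of_not hn]
  · have hv := isValidParam_param h8 h5 hP
    have hd : (-(p : ℤ)) < 0 := by have := h5; omega
    have cox := cox_formClassGroup_holds
    obtain ⟨f, hf, rfl⟩ := (csidhLab_param_iff hv _).1 hg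
    obtain ⟨f', hf', rfl⟩ := (csidhLab_param_iff hv _).1 hh
    obtain ⟨f'', hf'', rfl⟩ := (csidhLab_param_iff hv _).1 hk
    rw [csidhMul_param hv hf hf', csidhMul_param hv hf' hf'',
      csidhMul_param hv (isLabel_comp cox hd _ _) hf'',
      csidhMul_param hv hf (isLabel_comp cox hd _ _), comp_assoc cox hd]

/-- **Clause 5**: the law is commutative on labels (in fact on all arguments). [folklore] -/
theorem csidhMul_comm (g h : List Bool) : csidhMul P₀ prm g h = csidhMul P₀ prm h g := by
  rcases isValidParam_cases P₀ prm with hn | ⟨p, _, h8, h5, hP, rfl⟩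
  · rw [csidhMul_of_not hn, csidhMul_of_not hn]
  · by_cases hgh : IsLabelCode p g ∧ IsLabelCode p h
    · have hv := isValidParam_param h8 h5 hP
      obtain ⟨⟨f, hf, rfl⟩, ⟨f', hf', rfl⟩⟩ := hgh
      rw [csidhMul_param hv hf hf', csidhMul_param hv hf' hf, comp_comm]
    · rw [csidhMul_param_of_not g h hgh, csidhMul_param_of_not h g (fun h' => hgh ⟨h'.2, h'.1⟩)]

/-- **Clause 6**: every label has an inverse label. [folklore] -/
theorem exists_csidhMul_eq_csidhOne {g : List Bool} (hg : csidhLab P₀ prm g = true) :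
    ∃ h : List Bool, csidhLab P₀ prm h = true ∧ csidhMul P₀ prm g h = csidhOne P₀ prm := by
  rcases isValidParam_cases P₀ prm with hn | ⟨p, _, h8, h5, hP, rfl⟩
  · refine ⟨[], ?_, ?_⟩
    · rw [csidhLab_of_not hn]
      rfl
    · rw [csidhMul_of_not hn, csidhOne_of_not hn]
  · have hv := isValidParam_param h8 h5 hP
    have hd : (-(p : ℤ)) < 0 := by have := h5; omega
    have cox := cox_formClassGroup_holds
    obtain ⟨f, hf, rfl⟩ := (csidhLab_param_iff hv _).1 hg
    have hi : IsLabel (-(p : ℤ)) (inv (-(p : ℤ)) f) := isLabel_ofClass cox hd _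
    refine ⟨encForm (inv (-(p : ℤ)) f), ?_, ?_⟩
    · rw [csidhLab_param_encForm hv, decide_eq_true_iff]
      exact hi
    · rw [csidhMul_param hv hf hi, comp_inv cox hd, csidhOne_param hv]

end Group

/-! ### Torsor axioms (clauses 7, 8, 9) from clauses (1)–(2) of CSIDH Thm. 7, proved in the tree -/

section Torsor

variable (P₀ : ℕ) (prm : List Bool)

/-- **Clause 7**: the action preserves elements (`isCoeff_act'`). [folklore] -/
theorem csidhElt_csidhAct {g z : List Bool} (hg : csidhLab P₀ prm g = true)
    (hz : csidhElt P₀ prm z = true) : csidhElt P₀ prm (csidhAct P₀ prm g z) = true := by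
  rcases isValidParam_cases P₀ prm with hn | ⟨p, _, h8, h5, hP, rfl⟩
  · rwa [csidhAct_of_not hn]
  · have hv := isValidParam_param h8 h5 hP
    obtain ⟨f, hf, rfl⟩ := (csidhLab_param_iff hv _).1 hg
    obtain ⟨A, hA, rfl⟩ := (csidhElt_param_iff hv _).1 hz
    rw [csidhAct_param hv hf hA, csidhElt_param_encCoeff hv, decide_eq_true_iff]
    exact isCoeff_act' h8 hf hA

/-- **Clause 8**: the unit acts trivially (`act_principalForm'`). [folklore] -/
theorem csidhAct_csidhOne {z : List Bool} (hz : csidhElt P₀ prm z = true) :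
    csidhAct P₀ prm (csidhOne P₀ prm) z = z := by
  rcases isValidParam_cases P₀ prm with hn | ⟨p, _, h8, h5, hP, rfl⟩
  · rw [csidhAct_of_not hn]
  · have hv := isValidParam_param h8 h5 hP
    have hd : (-(p : ℤ)) < 0 := by have := h5; omega
    obtain ⟨A, hA, rfl⟩ := (csidhElt_param_iff hv _).1 hz
    rw [csidhOne_param hv, csidhAct_param hv (isLabel_principalForm _ hd) hA,
      act_principalForm' h8 h5 hA]

/-- **Clause 9**: compatibility of the action with the law (`act_comp'`). [folklore] -/
theorem csidhAct_csidhMul {g h z : List Bool} (hg : csidhLab P₀ prm g = true)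
    (hh : csidhLab P₀ prm h = true) (hz : csidhElt P₀ prm z = true) :
    csidhAct P₀ prm (csidhMul P₀ prm g h) z = csidhAct P₀ prm g (csidhAct P₀ prm h z) := by
  rcases isValidParam_cases P₀ prm with hn | ⟨p, _, h8, h5, hP, rfl⟩
  · rw [csidhAct_of_not hn, csidhAct_of_not hn, csidhAct_of_not hn]
  · have hv := isValidParam_param h8 h5 hP
    have hd : (-(p : ℤ)) < 0 := by have := h5; omega
    obtain ⟨f, hf, rfl⟩ := (csidhLab_param_iff hv _).1 hg
    obtain ⟨f', hf', rfl⟩ := (csidhLab_param_iff hv _).1 hh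
    obtain ⟨A, hA, rfl⟩ := (csidhElt_param_iff hv _).1 hz
    rw [csidhMul_param hv hf hf', csidhAct_param hv hf' hA,
      csidhAct_param hv (isLabel_comp cox_formClassGroup_holds hd _ _) hA,
      csidhAct_param hv hf (isCoeff_act' h8 hf' hA), act_comp' h8 h5 hf hf' hA]

/-- **Clause 10** (regularity) from clause (3) of `csidh_classGroupAction` at the primes of the
valid parameters: any two elements are joined by exactly one label. [folklore] -/
theorem existsUnique_csidhAct_eq
    (hfree : ∀ (p : ℕ) [Fact p.Prime], p % 8 = 3 → 5 ≤ p → P₀ ≤ p →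
      ∀ A₀ A₁ : ZMod p, IsCoeff p A₀ → IsCoeff p A₁ →
        ∃! f : BinQF, IsLabel (-(p : ℤ)) f ∧ act p f A₀ = A₁)
    {z₀ z₁ : List Bool} (h₀ : csidhElt P₀ prm z₀ = true) (h₁ : csidhElt P₀ prm z₁ = true) :
    ∃! g : List Bool, csidhLab P₀ prm g = true ∧ csidhAct P₀ prm g z₀ = z₁ := by
  rcases isValidParam_cases P₀ prm with hn | ⟨p, _, h8, h5, hP, rfl⟩
  · have e₀ := eq_nil_of_csidhElt_of_not hn h₀
    have e₁ := eq_nil_of_csidhElt_of_not hn h₁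
    subst e₀ e₁
    refine ⟨[], ⟨by rw [csidhLab_of_not hn]; rfl, csidhAct_of_not hn _ _⟩, fun g hg => ?_⟩
    exact eq_nil_of_csidhLab_of_not hn hg.1
  · have hv := isValidParam_param h8 h5 hP
    haveI : NeZero p := ⟨(Fact.out : p.Prime).ne_zero⟩
    obtain ⟨A₀, hA₀, rfl⟩ := (csidhElt_param_iff hv _).1 h₀
    obtain ⟨A₁, hA₁, rfl⟩ := (csidhElt_param_iff hv _).1 h₁
    obtain ⟨f, ⟨hf, hfA⟩, huniq⟩ := hfree p h8 h5 hP A₀ A₁ hA₀ hA₁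
    refine ⟨encForm f, ⟨?_, ?_⟩, fun g hg => ?_⟩
    · rw [csidhLab_param_encForm hv, decide_eq_true_iff]
      exact hf
    · rw [csidhAct_param hv hf hA₀, hfA]
    · obtain ⟨f', hf', rfl⟩ := (csidhLab_param_iff hv _).1 hg.1
      have h2 := hg.2
      rw [csidhAct_param hv hf' hA₀] at h2
      rw [huniq f' ⟨hf', encCoeff_injective p h2⟩]

end Torsor

/-! ### Generation (clause 13) from `Subgroup.closure (classes of gens p) = ⊤` -/

section Generation

variable {p : ℕ} [Fact p.Prime]

/-- In a finite commutative group, every element of the subgroup generated by the members of a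
list is an ordered product of natural powers of the members. [folklore] -/
theorem exists_eq_prod_zipWith_pow_of_mem_closure {G : Type*} [CommGroup G] [Finite G]
    (l : List G) {x : G} (hx : x ∈ Subgroup.closure {a | a ∈ l}) :
    ∃ es : List ℕ, x = (List.zipWith (fun a e => a ^ e) l es).prod := by
  induction l generalizing x with
  | nil =>
    refine ⟨[], ?_⟩
    have : ({a : G | a ∈ ([] : List G)}) = (∅ : Set G) := by
      ext a; simp
    rw [this, Subgroup.closure_empty, Subgroup.mem_bot] at hx
    simp [hx]
  | cons a l ih =>
    have hset : ({b : G | b ∈ a :: l}) = {a} ∪ {b | b ∈ l} := by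
      ext b; simp
    rw [hset, Subgroup.closure_union, Subgroup.mem_sup] at hx
    obtain ⟨y, hy, z, hz, rfl⟩ := hx
    rw [← Subgroup.zpowers_eq_closure, ← mem_powers_iff_mem_zpowers, Submonoid.mem_powers_iff]
      at hy
    obtain ⟨n, rfl⟩ := hy
    obtain ⟨es, rfl⟩ := ih hz
    exact ⟨n :: es, by simp⟩

/-- The class group of `ℤ[√-p]` is finite (Cox Thm. 7.7: `#C(𝒪) = h(-4p) > 0`). [folklore] -/
theorem finite_classGroup (hp : 1 ≤ p) : Finite (ClassGroup (ℤ√(-(p : ℤ)))) := by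
  have hd : (-(p : ℤ)) < 0 := by omega
  apply Nat.finite_of_card_ne_zero
  rw [card_classGroup_eq_classNumber cox_formClassGroup_holds hd]
  exact (classNumber_pos (by omega) (Or.inl (by omega))).ne'

variable {P₀ : ℕ}

/-- Iterating the law with a label code from the unit computes the code of the power of its
class. [folklore] -/
theorem iterate_csidhMul_csidhOne (hv : IsValidParam P₀ (param p)) (h5 : 5 ≤ p) {f : BinQF}
    (hf : IsLabel (-(p : ℤ)) f) (e : ℕ) :
    (csidhMul P₀ (param p) (encForm f))^[e] (csidhOne P₀ (param p)) =
      encForm (ofClass (-(p : ℤ)) (toClass (-(p : ℤ)) f ^ e)) := by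
  have hd : (-(p : ℤ)) < 0 := by omega
  have cox := cox_formClassGroup_holds
  induction e with
  | zero =>
    rw [Function.iterate_zero, id, pow_zero, csidhOne_param hv, ← toClass_principalForm (-(p : ℤ)),
      ofClass_toClass cox hd (isLabel_principalForm _ hd)]
  | succ e ih =>
    rw [Function.iterate_succ_apply', ih, csidhMul_param hv hf (isLabel_ofClass cox hd _), comp,
      toClass_ofClass cox hd, pow_succ']

/-- Folding the law over codes of labels of classes computes the code of the label of the
product. [folklore] -/
theorem foldr_csidhMul_map (hv : IsValidParam P₀ (param p)) (h5 : 5 ≤ p)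
    (cs : List (ClassGroup (ℤ√(-(p : ℤ))))) :
    (cs.map fun c => encForm (ofClass (-(p : ℤ)) c)).foldr (csidhMul P₀ (param p))
        (csidhOne P₀ (param p)) = encForm (ofClass (-(p : ℤ)) cs.prod) := by
  have hd : (-(p : ℤ)) < 0 := by omega
  have cox := cox_formClassGroup_holds
  induction cs with
  | nil =>
    rw [List.map_nil, List.foldr_nil, List.prod_nil, csidhOne_param hv,
      ← toClass_principalForm (-(p : ℤ)), ofClass_toClass cox hd (isLabel_principalForm _ hd)]
  | cons c cs ih =>
    rw [List.map_cons, List.foldr_cons, ih, List.prod_cons,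
      csidhMul_param hv (isLabel_ofClass cox hd _) (isLabel_ofClass cox hd _), comp,
      toClass_ofClass cox hd, toClass_ofClass cox hd]

/-- Entrywise, iterated powers of codes of labels are the codes of the powers of their classes.
[folklore] -/
theorem zipWith_iterate_csidhMul (hv : IsValidParam P₀ (param p)) (h5 : 5 ≤ p) :
    ∀ (l : List BinQF) (es : List ℕ), (∀ a ∈ l, IsLabel (-(p : ℤ)) a) →
      List.zipWith (fun a e => (csidhMul P₀ (param p) (encForm a))^[e] (csidhOne P₀ (param p)))
        l es = (List.zipWith (fun a e => toClass (-(p : ℤ)) a ^ e) l es).map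
          fun c => encForm (ofClass (-(p : ℤ)) c)
  | [], es, _ => by simp
  | a :: l, [], _ => by simp
  | a :: l, e :: es, hl => by
    rw [List.zipWith_cons_cons, List.zipWith_cons_cons, List.map_cons,
      iterate_csidhMul_csidhOne hv h5 (hl a (by simp)),
      zipWith_iterate_csidhMul hv h5 l es fun b hb => hl b (by simp [hb])]

/-- **Clause 13 on a valid parameter**: if the classes of `gens p` generate `cl(ℤ[√-p])`, every
label is the ordered product of iterated powers of the listed generators. [folklore] -/
theorem exists_eq_foldr_of_closure_eq_top (hv : IsValidParam P₀ (param p)) (h5 : 5 ≤ p)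
    (hgen : Subgroup.closure ((toClass (-(p : ℤ))) '' {f | f ∈ gens p}) = ⊤)
    {g : List Bool} (hg : csidhLab P₀ (param p) g = true) :
    ∃ es : List ℕ, g = (List.zipWith (fun h e => (csidhMul P₀ (param p) h)^[e]
      (csidhOne P₀ (param p))) (csidhGens P₀ (param p)) es).foldr (csidhMul P₀ (param p))
        (csidhOne P₀ (param p)) := by
  have hd : (-(p : ℤ)) < 0 := by omega
  have cox := cox_formClassGroup_holds
  haveI := finite_classGroup (p := p) (by omega)
  obtain ⟨f, hf, rfl⟩ := (csidhLab_param_iff hv _).1 hg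
  have hmem : toClass (-(p : ℤ)) f ∈
      Subgroup.closure {c | c ∈ (gens p).map (toClass (-(p : ℤ)))} := by
    have : {c | c ∈ (gens p).map (toClass (-(p : ℤ)))} =
        (toClass (-(p : ℤ))) '' {f | f ∈ gens p} := by
      ext c
      simp only [Set.mem_setOf_eq, List.mem_map, Set.mem_image]
    rw [this, hgen]
    exact Subgroup.mem_top _
  obtain ⟨es, hes⟩ := exists_eq_prod_zipWith_pow_of_mem_closure _ hmem
  refine ⟨es, ?_⟩
  rw [csidhGens_param hv, List.zipWith_map_left,
    zipWith_iterate_csidhMul hv h5 (gens p) es (fun a ha => isLabel_of_mem_gens ha),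
    foldr_csidhMul_map hv h5, ← List.zipWith_map_left (f := toClass (-(p : ℤ)))
      (g := fun a e => a ^ e), ← hes, ofClass_toClass cox hd hf]

end Generation

/-! ### The thirteen interface axioms, bundled -/

section Bundle

variable (P₀ : ℕ)

/-- **The CSIDH family satisfies the thirteen torsor axioms of the white-box interface** (in the
order of the route's `TorsorHard`), for every parameter string, given at the primes
`p ≡ 3 (mod 8)`, `p ≥ max 5 P₀`: clause (3) of CSIDH Thm. 7 (free and transitive action,
`csidh_classGroupAction`) and generation of `cl(ℤ[√-p])` by the classes of `gens p` (under GRH,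
`exists_closure_toClass_gens_eq_top`). Clauses (1)–(2) of Thm. 7 are the tree's theorems
`isCoeff_act'`, `act_principalForm'`, `act_comp'`; the group axioms are Cox Thm. 7.7
(`cox_formClassGroup_holds`). [folklore] -/
theorem torsorAxioms
    (hfree : ∀ (p : ℕ) [Fact p.Prime], p % 8 = 3 → 5 ≤ p → P₀ ≤ p →
      ∀ A₀ A₁ : ZMod p, IsCoeff p A₀ → IsCoeff p A₁ →
        ∃! f : BinQF, IsLabel (-(p : ℤ)) f ∧ act p f A₀ = A₁)
    (hgen : ∀ (p : ℕ) [Fact p.Prime], p % 8 = 3 → 5 ≤ p → P₀ ≤ p →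
      Subgroup.closure ((toClass (-(p : ℤ))) '' {f | f ∈ gens p}) = ⊤) :
    (∀ prm g h, csidhLab P₀ prm g = true → csidhLab P₀ prm h = true →
      csidhLab P₀ prm (csidhMul P₀ prm g h) = true) ∧
    (∀ prm, csidhLab P₀ prm (csidhOne P₀ prm) = true) ∧
    (∀ prm g, csidhLab P₀ prm g = true → csidhMul P₀ prm (csidhOne P₀ prm) g = g) ∧
    (∀ prm g h k, csidhLab P₀ prm g = true → csidhLab P₀ prm h = true → csidhLab P₀ prm k = true →
      csidhMul P₀ prm (csidhMul P₀ prm g h) k = csidhMul P₀ prm g (csidhMul P₀ prm h k)) ∧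
    (∀ prm g h, csidhLab P₀ prm g = true → csidhLab P₀ prm h = true →
      csidhMul P₀ prm g h = csidhMul P₀ prm h g) ∧
    (∀ prm g, csidhLab P₀ prm g = true →
      ∃ h, csidhLab P₀ prm h = true ∧ csidhMul P₀ prm g h = csidhOne P₀ prm) ∧
    (∀ prm g z, csidhLab P₀ prm g = true → csidhElt P₀ prm z = true →
      csidhElt P₀ prm (csidhAct P₀ prm g z) = true) ∧
    (∀ prm z, csidhElt P₀ prm z = true → csidhAct P₀ prm (csidhOne P₀ prm) z = z) ∧
    (∀ prm g h z, csidhLab P₀ prm g = true → csidhLab P₀ prm h = true → csidhElt P₀ prm z = true →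
      csidhAct P₀ prm (csidhMul P₀ prm g h) z = csidhAct P₀ prm g (csidhAct P₀ prm h z)) ∧
    (∀ prm z₀ z₁, csidhElt P₀ prm z₀ = true → csidhElt P₀ prm z₁ = true →
      ∃! g, csidhLab P₀ prm g = true ∧ csidhAct P₀ prm g z₀ = z₁) ∧
    (∀ prm g, csidhLab P₀ prm g = true → g.length ≤ prm.length) ∧
    (∀ prm, ∀ h ∈ csidhGens P₀ prm, csidhLab P₀ prm h = true) ∧
    (∀ prm g, csidhLab P₀ prm g = true → ∃ es : List ℕ,
      g = (List.zipWith (fun h e => (csidhMul P₀ prm h)^[e] (csidhOne P₀ prm)) (csidhGens P₀ prm)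
        es).foldr (csidhMul P₀ prm) (csidhOne P₀ prm)) := by
  refine ⟨fun prm g h => csidhLab_csidhMul P₀ prm, csidhLab_csidhOne P₀,
    fun prm g => csidhMul_csidhOne_left P₀ prm, fun prm g h k => csidhMul_assoc P₀ prm,
    fun prm g h _ _ => csidhMul_comm P₀ prm g h, fun prm g => exists_csidhMul_eq_csidhOne P₀ prm,
    fun prm g z => csidhElt_csidhAct P₀ prm, fun prm z => csidhAct_csidhOne P₀ prm,
    fun prm g h z => csidhAct_csidhMul P₀ prm,
    fun prm z₀ z₁ => existsUnique_csidhAct_eq P₀ prm (fun p _ => hfree p),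
    fun prm g => length_le_of_csidhLab P₀ prm, fun prm h => csidhLab_of_mem_csidhGens P₀ prm,
    fun prm g hg => ?_⟩
  rcases isValidParam_cases P₀ prm with hn | ⟨p, _, h8, h5, hP, rfl⟩
  · refine ⟨[], ?_⟩
    rw [eq_nil_of_csidhLab_of_not hn hg, csidhGens_of_not hn, List.zipWith_nil_left,
      List.foldr_nil, csidhOne_of_not hn]
  · exact exists_eq_foldr_of_closure_eq_top (isValidParam_param h8 h5 hP) h5 (hgen p h8 h5 hP) hg

/-- The same from the named facts as stated in the tree: CSIDH Thm. 7 (`csidh_classGroupAction`)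
and, under ERH, Jao–Miller–Venkatesan generation (`jmv_smallPrimesGenerate`) — for a suitable
threshold `P₀`. [folklore] -/
theorem exists_torsorAxioms (hcsidh : csidh_classGroupAction) (hjmv : jmv_smallPrimesGenerate)
    (hERH : Literature.NumberTheory.LFunctions.ExtendedRiemannHypothesis) :
    ∃ P₀ : ℕ,
    (∀ prm g h, csidhLab P₀ prm g = true → csidhLab P₀ prm h = true →
      csidhLab P₀ prm (csidhMul P₀ prm g h) = true) ∧
    (∀ prm, csidhLab P₀ prm (csidhOne P₀ prm) = true) ∧
    (∀ prm g, csidhLab P₀ prm g = true → csidhMul P₀ prm (csidhOne P₀ prm) g = g) ∧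
    (∀ prm g h k, csidhLab P₀ prm g = true → csidhLab P₀ prm h = true → csidhLab P₀ prm k = true →
      csidhMul P₀ prm (csidhMul P₀ prm g h) k = csidhMul P₀ prm g (csidhMul P₀ prm h k)) ∧
    (∀ prm g h, csidhLab P₀ prm g = true → csidhLab P₀ prm h = true →
      csidhMul P₀ prm g h = csidhMul P₀ prm h g) ∧
    (∀ prm g, csidhLab P₀ prm g = true →
      ∃ h, csidhLab P₀ prm h = true ∧ csidhMul P₀ prm g h = csidhOne P₀ prm) ∧
    (∀ prm g z, csidhLab P₀ prm g = true → csidhElt P₀ prm z = true →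
      csidhElt P₀ prm (csidhAct P₀ prm g z) = true) ∧
    (∀ prm z, csidhElt P₀ prm z = true → csidhAct P₀ prm (csidhOne P₀ prm) z = z) ∧
    (∀ prm g h z, csidhLab P₀ prm g = true → csidhLab P₀ prm h = true → csidhElt P₀ prm z = true →
      csidhAct P₀ prm (csidhMul P₀ prm g h) z = csidhAct P₀ prm g (csidhAct P₀ prm h z)) ∧
    (∀ prm z₀ z₁, csidhElt P₀ prm z₀ = true → csidhElt P₀ prm z₁ = true →
      ∃! g, csidhLab P₀ prm g = true ∧ csidhAct P₀ prm g z₀ = z₁) ∧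
    (∀ prm g, csidhLab P₀ prm g = true → g.length ≤ prm.length) ∧
    (∀ prm, ∀ h ∈ csidhGens P₀ prm, csidhLab P₀ prm h = true) ∧
    (∀ prm g, csidhLab P₀ prm g = true → ∃ es : List ℕ,
      g = (List.zipWith (fun h e => (csidhMul P₀ prm h)^[e] (csidhOne P₀ prm)) (csidhGens P₀ prm)
        es).foldr (csidhMul P₀ prm) (csidhOne P₀ prm)) := by
  obtain ⟨P₀, hP₀⟩ := exists_closure_toClass_gens_eq_top hjmv hERH
  exact ⟨P₀, torsorAxioms P₀ (fun p _ h8 h5 _ => (hcsidh p h8 h5).2.2)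
    (fun p _ h8 _ hP => hP₀ p hP (by omega))⟩

end Bundle


end Literature.Computability.Cryptography.Csidh
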